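import Summits.CriticalPhenomena.CardyFormulaZ2.Theorems.CardyUniqueLimitCardyRigiditySlitCrossingTipNegligible
import HarnessLib

/-!
# Vocabulary for the heart of `stub_slitObservableApprox`: fjords of the exploration and their negligibility

Crux `Summit.CriticalPhenomena.CardyFormulaZ2.Theses.CardyUniqueLimit.CardyRigidity`
(stmt-CriticalPhenomena-0746), line `crossing_martingale`, stub `stub_slitObservableApprox`
(`∀ f, AllRectangleKernel f → PercSlitObservableApprox f`).  This UNLANDED vocabulary file
(worker A3b of lead c2) states the research input (α) of the heart — the bond-`ℤ²` analogue of
Camia–Newman's hull-boundary convergence (PTRF 139 (2007), §6, Lemmas 6.1–6.4, and the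
close-encounter Lemmas 7.1–7.2) — in a FINITARY form about the discrete exploration alone,
through the landed vocabulary `EventIdentity.leftBank` / `unrevealedFreeGraph` /
`accessibleLeftBank` (…SlitCrossingEventIdentity.lean, …SlitCrossingTipNegligible.lean):

* `HullBoundary.RobustlyNear hD ω n X₁ ε'' ε v` — the site `v` is approached within `ε` from the
  source set `X₁` by a path of unrevealed free edges (any status) all of whose sites outside the
  `ε`-ball about `v` keep distance `≥ ε''` from the left bank of the prefix of depth `n`
  (an `ε''`-ROBUST access: no squeezing through gates of width `< 2ε''` between two pieces of
  the explored path, or between the path and `∂Ω`);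
* `HullBoundary.FjordAt hD ω n X₁ ε'' ε` — some ACCESSIBLE left-bank vertex (joined to `X₁`
  through unrevealed free edges) is not `ε''`-robustly approached within `ε`: it sits in a fjord
  of the prefix of size `≥ ε` all of whose mouths are narrower than `2ε''` — a close encounter of
  the exploration with itself or with the boundary WITHOUT touching;
* `PercFjordNegligible` — **(α), finitary**: for all `ε, r > 0` there are `ε'' > 0` and a mesh
  threshold `δ₀ > 0` such that for all admissible data of mesh `≤ δ₀` in the closed unit disc and
  every source set, the probability that a fjord event occurs at some depth of the exploration is
  `≤ r` (Camia–Newman's Lemmas 6.1/7.1: six-arm estimate in the bulk — for bond-`ℤ²` from the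
  five-arm exponent `2` of Kesten–Sidoravicius–Zhang, tree `ZdFiveArmUniqueness`/`KSZOfArms`, plus
  RSW/BK — and the half-plane three-arm estimate at the boundary, tree
  `Z2HalfPlane.real_threeArm_le`).  Off the fjord event every accessible left-bank vertex is
  within `ε` of the `ε''`-robustly accessible region, which converges to the slit domain seen
  from `X₁`; this is what places the target arc of the OUTER flower domain (hugging the left bank
  from inside the slit domain at distance `< ε''`) within reach of every slit crossing ending on
  the bank (the outer half of the sandwich; the inner half needs only the uniform closeness of
  the discrete prefix to the continuum hull).

Nothing is asserted; see `work/stubs/REPORT-stub_slitObservableApprox.md` for the intended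
assembly of `PercSlitObservableApprox f` from (α), the landed pieces, a flower catalogue for the
slit 4-gons of the disc and the transfer lemma for slit structures.
-/

noncomputable section

open MeasureTheory Set Metric
open scoped ENNReal
open Literature.Probability Literature.Probability.LatticeModels Literature.Probability.Percolation
open Literature.Probability.LatticeModels.DiscreteDobrushin

namespace Summit.CriticalPhenomena.CardyFormulaZ2.Cruxes.CardyRigidity.CrossingMartingale

namespace HullBoundary

variable {D : DiscreteDobrushin} (hD : D.IsZdAdmissible)

/-- **`ε''`-robust approach within `ε`.**  The site `v` is `ε''`-robustly approached within
`ε` from `X₁` at depth `n` of the exploration of `ω`: some `x ∈ X₁` is joined to a site `w`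
within `ε` of `v` by a walk of unrevealed free edges (of any status) all of whose sites either
lie within `ε` of `v` or keep distance `≥ ε''` from every left-bank vertex of the prefix.
(Camia–Newman 2007, §6: the discrete hull boundary seen from outside.) -/
def RobustlyNear (ω : BondConfig (Site 2)) (n : ℕ) (X₁ : Set (Site 2)) (ε'' ε : ℝ) (v : Site 2) : Prop :=
  ∃ x ∈ X₁, ∃ w : Site 2, dist (meshPoint D.δ w) (meshPoint D.δ v) ≤ ε ∧
    ∃ q : (EventIdentity.unrevealedFreeGraph hD ω n).Walk x w, ∀ z ∈ q.support,
      dist (meshPoint D.δ z) (meshPoint D.δ v) ≤ ε ∨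
        ∀ b ∈ EventIdentity.leftBank hD ω n, ε'' ≤ dist (meshPoint D.δ z) (meshPoint D.δ b)

/-- **The fjord event at depth `n`**: some accessible left-bank vertex of the prefix of depth
`n` (joined to `X₁` through unrevealed free edges) is NOT `ε''`-robustly approached within `ε`
from `X₁` — it lies in a fjord of size `≥ ε` all of whose mouths are gates narrower than `2ε''`
(a close encounter of the exploration with itself or with the boundary, without touching).
(Camia–Newman 2007, Lemmas 6.1 and 7.1.) -/
def FjordAt (ω : BondConfig (Site 2)) (n : ℕ) (X₁ : Set (Site 2)) (ε'' ε : ℝ) : Prop :=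
  ∃ v ∈ EventIdentity.accessibleLeftBank hD ω n X₁, ¬ RobustlyNear hD ω n X₁ ε'' ε v

variable {hD}

/-- Robust approach is monotone in the robustness scale: a smaller `ε''` is easier. [folklore] -/
theorem RobustlyNear.mono {ω : BondConfig (Site 2)} {n : ℕ} {X₁ : Set (Site 2)} {ε₁ ε₂ ε : ℝ}
    (h12 : ε₁ ≤ ε₂) {v : Site 2} (h : RobustlyNear hD ω n X₁ ε₂ ε v) : RobustlyNear hD ω n X₁ ε₁ ε v := by
  obtain ⟨x, hx, w, hw, q, hq⟩ := h
  exact ⟨x, hx, w, hw, q, fun z hz ↦ (hq z hz).imp_right fun h b hb ↦ h12.trans (h b hb)⟩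

/-- A robustly approached site is approached: some `x ∈ X₁` reaches within `ε` of it through
unrevealed free edges. [folklore] -/
theorem RobustlyNear.exists_reachable {ω : BondConfig (Site 2)} {n : ℕ} {X₁ : Set (Site 2)}
    {ε'' ε : ℝ} {v : Site 2} (h : RobustlyNear hD ω n X₁ ε'' ε v) :
    ∃ x ∈ X₁, ∃ w : Site 2, dist (meshPoint D.δ w) (meshPoint D.δ v) ≤ ε ∧
      (EventIdentity.unrevealedFreeGraph hD ω n).Reachable x w := by
  obtain ⟨x, hx, w, hw, q, -⟩ := h
  exact ⟨x, hx, w, hw, ⟨q⟩⟩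

/-- The fjord event is monotone in the robustness scale: a larger `ε''` gives more fjords. [folklore] -/
theorem FjordAt.mono {ω : BondConfig (Site 2)} {n : ℕ} {X₁ : Set (Site 2)} {ε₁ ε₂ ε : ℝ}
    (h12 : ε₁ ≤ ε₂) (h : FjordAt hD ω n X₁ ε₁ ε) : FjordAt hD ω n X₁ ε₂ ε := by
  obtain ⟨v, hv, hnot⟩ := h
  exact ⟨v, hv, fun h' ↦ hnot (h'.mono h12)⟩

end HullBoundary

/-- **Registered form** (glue `hullBoundary_fjordAt_mono` of stmt-CriticalPhenomena-0746): the fjord event is monotone in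
the robustness scale. [folklore] -/
theorem hullBoundary_fjordAt_mono : ∀ {D : DiscreteDobrushin} (hD : D.IsZdAdmissible) {ω : BondConfig (Site 2)} {n : ℕ} {X₁ : Set (Site 2)} {ε₁ ε₂ ε : ℝ}, ε₁ ≤ ε₂ → HullBoundary.FjordAt hD ω n X₁ ε₁ ε → HullBoundary.FjordAt hD ω n X₁ ε₂ ε :=
  fun _ _ _ _ _ _ _ h12 h ↦ h.mono h12

/-- **(α) Fjord negligibility of the bond-`ℤ²` exploration** (finitary form of Camia–Newman's
hull-boundary convergence, their Lemmas 6.1–6.4 and 7.1–7.2, for critical bond percolation on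
`ℤ²`): for all `ε, r > 0` there are `ε'' > 0` and `δ₀ > 0` such that for all admissible
square-lattice Dobrushin data of mesh `≤ δ₀` with domain in the closed unit disc and every source
set `X₁`, the `P_{1/2}`-probability that at some depth of the exploration some accessible
left-bank vertex is not `ε''`-robustly approached within `ε` from `X₁` is at most `r`.
(Sources: Camia–Newman 2007, §6 and Lemmas 7.1–7.2; Kesten–Sidoravicius–Zhang 1998 (five arms);
Smirnov–Werner 2001.  A sub-goal of the crux, stated as a predicate of this route —
deliberately NOT a cited Literature fact: the bond-`ℤ²` version with this accessibility
phrasing is not in print.) -/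
def PercFjordNegligible : Prop :=
  ∀ ε : ℝ, 0 < ε → ∀ r : ℝ, 0 < r → ∃ ε'' : ℝ, 0 < ε'' ∧ ∃ δ₀ : ℝ, 0 < δ₀ ∧
    ∀ (D : DiscreteDobrushin) (hD : D.IsZdAdmissible), D.δ ≤ δ₀ → D.Ω ⊆ closedBall (0 : ℂ) 1 →
      ∀ X₁ : Set (Site 2),
        bondPercolation (zdGraph 2) half
          {ω | ∃ n ≤ exitTime hD ω, HullBoundary.FjordAt hD ω n X₁ ε'' ε} ≤ ENNReal.ofReal r

end Summit.CriticalPhenomena.CardyFormulaZ2.Cruxes.CardyRigidity.CrossingMartingale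

end
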